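import Literature.Geometry.Symplectic.GromovCompactnessSpheresProofs
import Literature.Geometry.Manifold.TopFormIntegralPeriod
import HarnessLib

/-!
# Gromov compactness for `J`-spheres, dichotomy form — proofs, II: the energy bound

Second sibling proof file of `GromovCompactnessSpheres.lean` (the named fact
`Literature.Geometry.Symplectic.gromovCompactness_spheres_dichotomy`, McDuff–Salamon (2012),
Thm. 5.3.1). The printed theorem assumes a uniform ENERGY BOUND `sup_ν E(uᵛ) < ∞`,
`E(u) = ∫_{S²} u^*ω`; the fact instead fixes the homotopy class of the glued maps `Fₙ ≃ F₀`.
McDuff–Salamon (2012), Lemma 2.2.1 (the energy identity `E(u) = ∫ u^*ω = ⟨[ω], [u]⟩` for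
`J`-holomorphic `u` and `ω`-tame `J`; in general `∫ u^*ω` depends only on the homology class of
`u`) converts one into the other. Here, with the energy written as the tree's manifold integral
`MForm.integral` of the pulled-back form `F^*ω` over `ℂℙ¹` for a constant (complex) orientation
family `x ↦ o₀` (continuous: `isContinuousOrientation_const_complexProjectiveSpace`):

* `exists_integral_pullback_eq_mul_period` — there is a constant `c` (depending only on the
  orientation data of `ℂℙ¹`) with `∫_{ℂℙ¹} F^*ω = c · ⟨[ω], F_*[ℂℙ¹]⟩` for every compact
  `4`-manifold `X`, closed smooth `2`-form `ω` and `C^∞` map `F : ℂℙ¹ → X` (the general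
  proportionality `Literature.Geometry.Manifold.exists_integral_eq_mul_kroneckerPairing` and
  naturality of de Rham's isomorphism, Lee (2013), Thm. 18.14);
* `integral_pullback_eq_of_homotopic` — **`∫_{ℂℙ¹} F^*ω = ∫_{ℂℙ¹} G^*ω` for homotopic `C^∞` maps**;
* `integral_pullback_glued_eq` — under the hypotheses of the fact, **the energies
  `∫_{ℂℙ¹} Fₙ^*ω` of all the spheres of the sequence are equal** (in particular bounded): the
  hypothesis of McDuff–Salamon (2012), Thm. 5.3.1.

Everything is proved; no definitions, no named facts. The identification of `∫_{ℂℙ¹} F^*ω` with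
the chart integral `∫_ℂ u^*ω(∂ₛ, ∂ₜ) ds dt` and the value `c = ±1` are not needed for the bound
and are not recorded.

## References

* D. McDuff, D. Salamon, *J-holomorphic Curves and Symplectic Topology*, 2nd ed., AMS Colloquium
  Publ. 52 (2012), Lemma 2.2.1, Thm. 5.3.1. [McDuffSalamon2012]
* J. M. Lee, *Introduction to Smooth Manifolds*, 2nd ed. (2013), Thm. 17.31, Thm. 18.14.
  [LeeSmoothManifolds2013]
-/

noncomputable section

open scoped Manifold ContDiff Topology EuclideanSpace
open Set Function Module Filter
open Literature.AlgebraicTopology.SingularHomology Literature.Geometry.Kaehler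
  Literature.NumberTheory.Transcendental Literature.Geometry.Manifold
  Literature.Topology.FourManifolds Literature.Topology.FourManifolds.ComplexProjectiveSpace

namespace Literature.Geometry.Symplectic

/-- **The energy is proportional to the symplectic period.** For a constant orientation family
`x ↦ o₀` of `ℂℙ¹` and a `ℤ`-orientation `μ` there is `c : ℝ` such that for every compact
`4`-manifold `X`, every closed smooth `2`-form `ω` on `X` and every `C^∞` map `F : ℂℙ¹ → X`,
`∫_{(ℂℙ¹, o₀)} F^*ω = c · ⟨[ω], F_*[ℂℙ¹]_μ ⊗ 1⟩` (McDuff–Salamon (2012), Lemma 2.2.1: the energy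
`∫ u^*ω` is the pairing of `[ω]` with the class of `u`; here up to the universal constant relating
integration and de Rham's isomorphism on `ℂℙ¹`). [cite: McDuffSalamon2012, Lemma 2.2.1] -/
theorem exists_integral_pullback_eq_mul_period
    (o₀ : Orientation ℝ (EuclideanSpace ℝ (Fin (2 * 1))) (Fin (2 * 1)))
    (μ : HomologicalOrientation ℤ (ComplexProjectiveSpace 1) (2 * 1)) :
    ∃ c : ℝ, ∀ {X : Type} [TopologicalSpace X] [T2Space X] [CompactSpace X]
      [ChartedSpace (EuclideanSpace ℝ (Fin 4)) X] [IsManifold (𝓡 4) ∞ X]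
      (ωX : MForm (𝓡 4) X ℝ 2) (hω : IsSmoothForm ωX) (hcl : IsClosedForm ωX)
      {F : ComplexProjectiveSpace 1 → X} (hF : ContMDiff (𝓡 (2 * 1)) (𝓡 4) ∞ F),
      MForm.integral (I := 𝓡 (2 * 1)) (M := ComplexProjectiveSpace 1) (fun _ ↦ o₀)
          (ωX.pullback (𝓡 (2 * 1)) F) =
        c * periodFunctional ωX hω hcl
          (singularHomology.map ℤ ℤ ⟨F, hF.continuous⟩ (2 * 1) μ.fundamentalClass) := by
  obtain ⟨c, hc⟩ := exists_integral_eq_mul_kroneckerPairing μ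
    (isContinuousOrientation_const_complexProjectiveSpace 1 o₀)
  refine ⟨c, ?_⟩
  intro X _ _ _ _ _ ωX hω hcl F hF
  haveI : LocallyCompactSpace X := ChartedSpace.locallyCompactSpace (EuclideanSpace ℝ (Fin 4)) X
  haveI : SecondCountableTopology X :=
    ChartedSpace.secondCountable_of_sigmaCompact (EuclideanSpace ℝ (Fin 4)) X
  haveI : LocallyCompactSpace (ComplexProjectiveSpace 1) :=
    ChartedSpace.locallyCompactSpace (EuclideanSpace ℝ (Fin (2 * 1))) (ComplexProjectiveSpace 1)
  have hnat : periodFunctional ωX hω hcl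
      (singularHomology.map ℤ ℤ ⟨F, hF.continuous⟩ (2 * 1) μ.fundamentalClass) =
      kroneckerPairing ℝ ℝ (ComplexProjectiveSpace 1) (2 * 1)
        (integrationDeRhamIsoFamily (EuclideanSpace ℝ (Fin (2 * 1))) (ComplexProjectiveSpace 1)
          (2 * 1) (deRhamCohomology.mk ⟨ωX.pullback (𝓡 (2 * 1)) F,
            pullback_mem_closedSmoothForms hF ⟨hω, hcl⟩⟩))
        (singularHomology.coeffChange (ComplexProjectiveSpace 1)
          (algebraMap ℤ ℝ : ℤ →+* ℝ).toAddMonoidHom (2 * 1) μ.fundamentalClass) := by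
    rw [periodFunctional_apply, singularHomology.coeffChange_map, realClassOfClosedForm_eq,
      intCastAddHom_real_eq_algebraMap, ← kroneckerPairing_map,
      ← integrationDeRhamIsoFamily_map_of_contMDiff hF (2 * 1), deRhamCohomology.map_mk]
  rw [hnat]
  exact hc ⟨ωX.pullback (𝓡 (2 * 1)) F, pullback_mem_closedSmoothForms hF ⟨hω, hcl⟩⟩

variable {X : Type} [TopologicalSpace X] [T2Space X] [CompactSpace X]
  [ChartedSpace (EuclideanSpace ℝ (Fin 4)) X] [IsManifold (𝓡 4) ∞ X]

/-- **The energy `∫_{ℂℙ¹} F^*ω` depends only on the homotopy class of `F`** (`C^∞` maps, closed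
smooth `2`-form `ω`, constant orientation family of `ℂℙ¹`): McDuff–Salamon (2012), Lemma 2.2.1
(`∫ u^*ω = ⟨[ω], [u]⟩` and homotopic maps have the same class, Hatcher (2002), Thm. 2.10).
[cite: McDuffSalamon2012, Lemma 2.2.1] -/
theorem integral_pullback_eq_of_homotopic
    (o₀ : Orientation ℝ (EuclideanSpace ℝ (Fin (2 * 1))) (Fin (2 * 1)))
    (ωX : MForm (𝓡 4) X ℝ 2) (hω : IsSmoothForm ωX) (hcl : IsClosedForm ωX)
    {F G : ComplexProjectiveSpace 1 → X} (hF : ContMDiff (𝓡 (2 * 1)) (𝓡 4) ∞ F)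
    (hG : ContMDiff (𝓡 (2 * 1)) (𝓡 4) ∞ G)
    (h : (⟨F, hF.continuous⟩ : C(ComplexProjectiveSpace 1, X)).Homotopic ⟨G, hG.continuous⟩) :
    MForm.integral (I := 𝓡 (2 * 1)) (M := ComplexProjectiveSpace 1) (fun _ ↦ o₀)
        (ωX.pullback (𝓡 (2 * 1)) F) =
      MForm.integral (I := 𝓡 (2 * 1)) (M := ComplexProjectiveSpace 1) (fun _ ↦ o₀)
        (ωX.pullback (𝓡 (2 * 1)) G) := by
  obtain ⟨c, hc⟩ := exists_integral_pullback_eq_mul_period o₀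
    (ComplexProjectiveSpace.homologicalOrientationInt 1)
  rw [hc ωX hω hcl hF, hc ωX hω hcl hG, period_eq_of_homotopic ωX hω hcl h]

/-- **The energy bound of Gromov compactness from a fixed homotopy class.** Under the hypotheses
of `Literature.Geometry.Symplectic.gromovCompactness_spheres_dichotomy` (two-chart `C^∞` spheres
`(uₙ, vₙ)` with glued maps `Fₙ`, all homotopic to a fixed `F₀`; closed smooth `2`-form `ω`), the
energies `∫_{ℂℙ¹} Fₙ^*ω` of all the spheres of the sequence coincide — in particular
`sup_n E(uₙ) < ∞`, the hypothesis of McDuff–Salamon (2012), Thm. 5.3.1.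
[cite: McDuffSalamon2012, Thm. 5.3.1 and Lemma 2.2.1] -/
theorem integral_pullback_glued_eq
    (o₀ : Orientation ℝ (EuclideanSpace ℝ (Fin (2 * 1))) (Fin (2 * 1)))
    (ωX : MForm (𝓡 4) X ℝ 2) (hω : IsSmoothForm ωX) (hcl : IsClosedForm ωX)
    (us vs : ℕ → ℂ → X) (Fs : ℕ → C(ComplexProjectiveSpace 1, X))
    (F₀ : C(ComplexProjectiveSpace 1, X))
    (hsmooth : ∀ n, ContMDiff 𝓘(ℝ, ℂ) (𝓡 4) ∞ (us n) ∧ ContMDiff 𝓘(ℝ, ℂ) (𝓡 4) ∞ (vs n))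
    (hglue : ∀ n, (∀ p, CoordNeZero 0 p → Fs n p = us n (affineCoordComplex 0 p 0)) ∧
      (∀ p, CoordNeZero 1 p → Fs n p = vs n (affineCoordComplex 1 p 0)))
    (hhom : ∀ n, (Fs n).Homotopic F₀) (n m : ℕ) :
    MForm.integral (I := 𝓡 (2 * 1)) (M := ComplexProjectiveSpace 1) (fun _ ↦ o₀)
        (ωX.pullback (𝓡 (2 * 1)) (Fs n)) =
      MForm.integral (I := 𝓡 (2 * 1)) (M := ComplexProjectiveSpace 1) (fun _ ↦ o₀)
        (ωX.pullback (𝓡 (2 * 1)) (Fs m)) := by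
  have hFs : ∀ k, ContMDiff (𝓡 (2 * 1)) (𝓡 4) ∞ (Fs k) := fun k ↦
    contMDiff_glued (uv := ![us k, vs k]) (Fin.forall_fin_two.2 ⟨(hsmooth k).1, (hsmooth k).2⟩)
      (Fin.forall_fin_two.2 ⟨(hglue k).1, (hglue k).2⟩)
  exact integral_pullback_eq_of_homotopic o₀ ωX hω hcl (hFs n) (hFs m)
    ((hhom n).trans (hhom m).symm)

/-! ### The image of a glued two-chart sphere -/

omit [T2Space X] [CompactSpace X] [ChartedSpace (EuclideanSpace ℝ (Fin 4)) X]
  [IsManifold (𝓡 4) ∞ X] in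
/-- The inverse affine chart lands in its chart domain: `pᵢ ≠ 0` at `(affineChart i)⁻¹ w`.
[folklore] -/
theorem coordNeZero_affineChart_symm (i : Fin 2) (w : EuclideanSpace ℝ (Fin (2 * 1))) :
    CoordNeZero i ((affineChart (n := 1) i).symm w) :=
  (affineChart (n := 1) i).map_target (mem_univ _)

omit [T2Space X] [CompactSpace X] [ChartedSpace (EuclideanSpace ℝ (Fin 4)) X]
  [IsManifold (𝓡 4) ∞ X] in
/-- The complex affine coordinate of `(affineChart i)⁻¹ (realCoordinates z)` is `z`. [folklore] -/
theorem affineCoordComplex_affineChart_symm (i : Fin 2) (z : ℂ) :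
    affineCoordComplex i ((affineChart (n := 1) i).symm (realCoordinates 1 fun _ ↦ z)) 0 = z := by
  rw [affineCoordComplex_apply_zero_eq, (affineChart (n := 1) i).right_inv (mem_univ _)]
  simp

omit [T2Space X] [CompactSpace X] [ChartedSpace (EuclideanSpace ℝ (Fin 4)) X]
  [IsManifold (𝓡 4) ∞ X] in
/-- Off the chart domain `{p₀ ≠ 0}` of `ℂℙ¹` there is only the point `[0 : 1]`, whose affine
coordinate in the chart `{p₁ ≠ 0}` is `0`. [folklore] -/
theorem affineCoordComplex_one_eq_zero_of_not_coordNeZero {p : ComplexProjectiveSpace 1}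
    (hp : ¬ CoordNeZero 0 p) : CoordNeZero 1 p ∧ affineCoordComplex 1 p 0 = 0 := by
  induction p using ComplexProjectiveSpace.ind with
  | h w =>
    rw [coordNeZero_mk, not_not] at hp
    obtain ⟨i, hi⟩ := exists_coordNeZero (mk w)
    have hi1 : i = 1 := by
      fin_cases i
      · exact absurd hp ((coordNeZero_mk 0 w).1 hi)
      · rfl
    subst hi1
    refine ⟨hi, ?_⟩
    rw [affineCoordComplex_mk]
    simp [hp]

omit [TopologicalSpace X] [T2Space X] [CompactSpace X] [ChartedSpace (EuclideanSpace ℝ (Fin 4)) X]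
  [IsManifold (𝓡 4) ∞ X] in
/-- **The image of a glued two-chart sphere** `(u, v)` with glued map `F : ℂℙ¹ → X` is
`im u ∪ {v 0}` (`v 0 = F [0 : 1]` is the only value not attained on the chart `{p₀ ≠ 0}`): the set
`range (us k) ∪ {vs k 0}` in the Hausdorff-convergence clauses of
`gromovCompactness_spheres_dichotomy` is the image of the `k`-th sphere. [folklore] -/
theorem range_glued_eq {u v : ℂ → X} {F : ComplexProjectiveSpace 1 → X}
    (hF0 : ∀ p, CoordNeZero 0 p → F p = u (affineCoordComplex 0 p 0))
    (hF1 : ∀ p, CoordNeZero 1 p → F p = v (affineCoordComplex 1 p 0)) :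
    range F = range u ∪ {v 0} := by
  apply Subset.antisymm
  · rintro _ ⟨p, rfl⟩
    by_cases hp : CoordNeZero 0 p
    · exact Or.inl ⟨_, (hF0 p hp).symm⟩
    · obtain ⟨h1, h0⟩ := affineCoordComplex_one_eq_zero_of_not_coordNeZero hp
      right
      rw [mem_singleton_iff, hF1 p h1, h0]
  · rintro y (⟨z, rfl⟩ | hy)
    · refine ⟨(affineChart (n := 1) 0).symm (realCoordinates 1 fun _ ↦ z), ?_⟩
      rw [hF0 _ (coordNeZero_affineChart_symm 0 _), affineCoordComplex_affineChart_symm]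
    · rw [mem_singleton_iff] at hy
      subst hy
      refine ⟨(affineChart (n := 1) 1).symm (realCoordinates 1 fun _ ↦ 0), ?_⟩
      rw [hF1 _ (coordNeZero_affineChart_symm 1 _), affineCoordComplex_affineChart_symm]

end Literature.Geometry.Symplectic

end
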